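import Literature.Analysis.FluidPDE.TsaiLemma42ForcedUnit
import Mathlib.MeasureTheory.Measure.Hausdorff
import HarnessLib

/-!
# Tsai 1998, Lemma 4.2 and the `μH[1]`-null top singular set, WITH A FORCE (every viscosity,
  general `L³` force)

Analysis/FluidPDE proofs file (no definitions, no named facts). The tree's named facts
`tsai1998_lemma42` / `tsai1998_top_singular_null` (`TsaiLocalEnergy`; T.-P. Tsai, Arch. Rational
Mech. Anal. 143 (1998), Lemma 4.2 and the remark following it, p. 46: "as in the proof of
Theorem B in [CKN, p. 807], this lemma implies that the singular set at the top of the parabolic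
cylinder also has one-dimensional Hausdorff measure zero") are printed and proved
(`tsai1998_top_singular_null_holds`) for the UNFORCED equations. Caffarelli–Kohn–Nirenberg's
Proposition 2 and Theorem B carry a force `f ∈ L^q`, `q > 5/2` (CKN 1982, (2.3′), with `div f = 0`
— "if `f` is not divergence free, its gradient part may be absorbed into the pressure", §1). This
file proves the FORCED backward statements, in Lemarié-Rieusset's §14.3 class
`IsLRSuitableWeakSolutionOn (Q_ρ(T, x₀)) ν 3 f u p G` (force exponent `3`, NO solenoidality
assumed):

* `IsLRSuitableWeakSolutionOn.of_le_of_isConnected` — restriction of the §14.3 class to a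
  connected open subset;
* `tsai1998_lemma42_forced_of_unit` — every viscosity and a general `L³` force from the unit
  statement with solenoidal force (`tsai1998_lemma42_forced_unit`, `TsaiLemma42ForcedUnit`):
  around the point choose a viscous cylinder `Q_ν(z, R) ⊆ Q_ρ(T, x₀)`, restrict, rescale to the
  unit cylinder with viscosity `1` (`IsLRSuitableWeakSolutionOn.stRescale`, Escauriaza–Seregin–Šverák
  2003, §3), ABSORB THE GRADIENT PART OF THE FORCE INTO THE PRESSURE on the unit cylinder
  (`exists_localHelmholtz`, `isLRSuitableWeakSolutionOn_absorb`, `divFree_absorb` of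
  `CKNEpsilonRegularityForce`; the velocity and its gradient are unchanged, `u ∈ L³(Q₁)` by the
  interpolation inequality), apply the unit statement at the top centre `(0, 0)`, transport back;
* **`tsai1998_lemma42_forced`** — Lemma 4.2 with force: for every `ν > 0` there is `ε > 0` such
  that for every datum in the §14.3 class on `Q_ρ(T, x₀)` and every `z = (t, x)`,
  `T - ρ² < t ≤ T`, `x ∈ B_ρ(x₀)`: `limsup_{r→0⁺} r⁻¹ ∫∫_{Q_r(z)} |G|² ≤ ε` implies
  `u ∈ L^∞(Q_{r₁}(z))` for some `r₁ > 0`;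
* **`tsai1998_top_singular_null_forced`** — the covering argument of CKN's Theorem B at the top
  (word for word the tree's `tsai1998_top_singular_null_of_lemma42`): the set of `x ∈ B_ρ(x₀)` with
  `(T, x)` a backward singular point (`IsBackwardSingularPoint u (T, x)`) is `μH[1]`-null.

`-- TODO(general form): CKN's force class is f ∈ L^q(Q), q > 5/2; here q = 3.`

## Mathlib / tree search

Tree (all used): `tsai1998_lemma42_forced_unit` (`TsaiLemma42ForcedUnit`);
`IsLRSuitableWeakSolutionOn.stRescale` (`CKNEpsilonRegularityProofs`); `exists_localHelmholtz`
(`LocalHelmholtzForce`); `isLRSuitableWeakSolutionOn_absorb`, `divFree_absorb`, `memLp_f`,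
`memLp_indicator_cyl`, `AbsorbForce.p32_le_ofReal` (`CKNEpsilonRegularityForce`);
`interpolationEstimate_holds`, `cknAEss_le_of_energy`, `cknE_le_of_subset`,
`exists_forall_lt_of_limsup_le`; `viscousCylinder(Opens)`, `stPreimage_viscousCylinderOpens_self`,
`viscousCylinderOpens_one_one_zero`, `stAffine_preimage_viscousCylinder(_self)` (`NSSuitableESS`);
`le_sq_of_le_of_one_le`, `viscousCylinder_subset_parabolicCylinder`,
`parabolicCylinder_subset_viscousCylinder` (`TsaiLocalEnergyProofs`);
`setLIntegral_frobeniusNormSq_stRescale`, `ae_restrict_of_ae_restrict_preimage_stAffine`,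
`smul_stPull_apply` (`SpaceTimeRescaling`); `ediam_closedBall_le_ofReal`,
`disjoint_parabolicCylinder_of_disjoint_closedBall`, `IsBackwardSingularPoint` (`TsaiLocalEnergy`,
`LocalTypeI`). Mathlib: `Vitali.exists_disjoint_subfamily_covering_enlargement_closedBall`,
`Measure.hausdorffMeasure_le_liminf_tsum`, `tendsto_measure_iInter_atTop`.

## References

* T.-P. Tsai, *On Leray's self-similar solutions of the Navier–Stokes equations satisfying local
  energy estimates*, Arch. Rational Mech. Anal. 143 (1998) 29–51: Lemma 4.2 and the following
  remark (p. 46). [Tsai1998]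
* L. Caffarelli, R. Kohn, L. Nirenberg, *Partial regularity of suitable weak solutions of the
  Navier–Stokes equations*, Comm. Pure Appl. Math. 35 (1982) 771–831: §1, (2.3′), Proposition 2,
  Theorem B and its proof (§6, p. 807). [CaffarelliKohnNirenberg1982]
* P. G. Lemarié-Rieusset, *The Navier–Stokes Problem in the 21st Century*, CRC Press (2016):
  §14.3, Thm. 14.4 (p. 505); Thm. 13.9 (p. 479). [LemarieRieusset2016]
* L. Escauriaza, G. Seregin, V. Šverák, *`L_{3,∞}`-solutions of Navier–Stokes equations and
  backward uniqueness*, Russ. Math. Surveys 58 (2003): §3 (scaling). [EscauriazaSereginSverak2003]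
-/

noncomputable section

open MeasureTheory Set Function Filter Topology TopologicalSpace Metric
open scoped NNReal ENNReal InnerProductSpace RealInnerProductSpace

namespace Literature.Analysis.FluidPDE

open AbsorbForce LocalHelmholtz

/-! ## Restriction of the §14.3 class to a connected open subset -/

/-- **Restriction of Lemarié-Rieusset's §14.3 class** to a connected open subset `Q' ⊆ Q`: the
global classes on `Q` bound those on `Q'`, the equations, the weak gradient and the local energy
inequality are tested with fewer test functions. [cite: LemarieRieusset2016, §14.3 hypotheses of Thm. 14.4 (p. 505)] -/
theorem IsLRSuitableWeakSolutionOn.of_le_of_isConnected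
    {Q Q' : Opens (ℝ × EuclideanSpace ℝ (Fin 3))} {ν q : ℝ}
    {f u : ℝ → EuclideanSpace ℝ (Fin 3) → EuclideanSpace ℝ (Fin 3)}
    {p : ℝ → EuclideanSpace ℝ (Fin 3) → ℝ}
    {G : ℝ → EuclideanSpace ℝ (Fin 3) → EuclideanSpace ℝ (Fin 3) →L[ℝ] EuclideanSpace ℝ (Fin 3)}
    (h : IsLRSuitableWeakSolutionOn Q ν q f u p G) (hQ : Q' ≤ Q)
    (hc : IsConnected (Q' : Set (ℝ × EuclideanSpace ℝ (Fin 3)))) :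
    IsLRSuitableWeakSolutionOn Q' ν q f u p G := by
  have hsub : (Q' : Set (ℝ × EuclideanSpace ℝ (Fin 3))) ⊆ (Q : Set (ℝ × EuclideanSpace ℝ (Fin 3))) :=
    fun z hz => hQ hz
  refine
    { isConnected := hc
      energyClass := ?_
      weakGradient := h.weakGradient.mono hQ
      gradient_lt_top := (lintegral_mono_set hsub).trans_lt h.gradient_lt_top
      pressure_lt_top := (lintegral_mono_set hsub).trans_lt h.pressure_lt_top
      force_memLp := h.force_memLp.mono_measure (Measure.restrict_mono hsub le_rfl)
      distributional := h.distributional.of_le hQ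
      localEnergy := fun φ hφ hφ0 => h.localEnergy φ (hφ.mono hQ) hφ0 }
  obtain ⟨C, hC⟩ := h.energyClass
  refine ⟨C, ?_⟩
  filter_upwards [hC] with t ht
  refine (lintegral_mono fun x => ?_).trans ht
  exact indicator_le_indicator_of_subset hsub (fun _ => zero_le) _

/-- Viscous cylinders of positive radius are connected. [folklore] -/
private theorem isConnected_viscousCylinder {ν R : ℝ} (hν : 0 < ν) (hR : 0 < R)
    (z : ℝ × EuclideanSpace ℝ (Fin 3)) : IsConnected (viscousCylinder ν R z) := by
  refine ⟨⟨(z.1 - R ^ 2 / ν / 2, z.2), ?_⟩, ?_⟩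
  · rw [mem_viscousCylinder, dist_self]
    have : 0 < R ^ 2 / ν := by positivity
    exact ⟨⟨by linarith, by linarith⟩, hR⟩
  · rw [viscousCylinder]
    exact ((convex_Ioo _ _).prod (convex_ball _ _)).isPreconnected

/-! ## Lemma 4.2 with force: every viscosity, general `L³` force -/

/-- **Tsai 1998, Lemma 4.2 with a force, for every viscosity and a general `L³` force, from the
unit statement with solenoidal force** (the conclusion shape of `tsai1998_lemma42_forced_unit`).
Around a point `z = (t, x)` of the cylinder (top included) choose a viscous cylinder
`Q_ν(z, R) = (t - R²/ν, t) × B_R(x)` inside `Q_ρ(T, x₀)`, restrict the datum to it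
(`IsLRSuitableWeakSolutionOn.of_le_of_isConnected`), pull it back to the unit cylinder with
viscosity `1` by `w(s, y) = (R/ν) u(t + (R²/ν)s, x + Ry)` (`IsLRSuitableWeakSolutionOn.stRescale`,
Escauriaza–Seregin–Šverák 2003, §3), absorb the gradient part of the (localised) force into the
pressure on the unit cylinder (`exists_localHelmholtz`, `isLRSuitableWeakSolutionOn_absorb`,
`divFree_absorb`; Caffarelli–Kohn–Nirenberg 1982, §1) — this changes neither the velocity nor its
gradient, and `w ∈ L³(Q₁)` by the interpolation inequality — and apply the unit statement at the
top centre `(0, 0)`: the scaled dissipation transforms as `E_w(r'; 0) ≤ (m/ν) E_u(mRr'; z)`,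
`m = max 1 ν⁻¹`, so the `limsup` smallness is inherited with `ε = ε₁ν/(2m)`, and the bound on `w`
near `(0, 0)` is a bound on `u` on `Q_{Rr₁'/m'}(z)`, `m' = max 1 ν`.
[cite: Tsai1998, Lemma 4.2 (p. 46)] [cite: CaffarelliKohnNirenberg1982, Proposition 2 and §1] -/
theorem tsai1998_lemma42_forced_of_unit (hIE : interpolationEstimate)
    (H : ∃ ε : ℝ, 0 < ε ∧
      ∀ (ρ T : ℝ) (x₀ : EuclideanSpace ℝ (Fin 3))
        (f u : ℝ → EuclideanSpace ℝ (Fin 3) → EuclideanSpace ℝ (Fin 3))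
        (p : ℝ → EuclideanSpace ℝ (Fin 3) → ℝ)
        (G : ℝ → EuclideanSpace ℝ (Fin 3) → EuclideanSpace ℝ (Fin 3) →L[ℝ] EuclideanSpace ℝ (Fin 3)),
        0 < ρ →
        IsLRSuitableWeakSolutionOn (parabolicCylinderOpens ρ (T, x₀)) 1 3 f u p G →
        (∀ φ : ℝ → EuclideanSpace ℝ (Fin 3) → ℝ,
          IsSpaceTimeTestOn (parabolicCylinderOpens ρ (T, x₀)) φ →
            ∫ t, ∫ x, ⟪f t x, gradient (φ t) x⟫ = 0) →
        ∀ z : ℝ × EuclideanSpace ℝ (Fin 3), z.1 ∈ Ioc (T - ρ ^ 2) T → z.2 ∈ ball x₀ ρ →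
          limsup (fun r : ℝ => (ENNReal.ofReal r)⁻¹ *
              ∫⁻ w in parabolicCylinder r z, ENNReal.ofReal (frobeniusNormSq (G w.1 w.2)))
            (𝓝[>] (0 : ℝ)) ≤ ENNReal.ofReal ε →
          ∃ r₁ : ℝ, 0 < r₁ ∧
            eLpNorm (uncurry u) ⊤ (volume.restrict (parabolicCylinder r₁ z)) < ⊤) :
    ∀ ν : ℝ, 0 < ν → ∃ ε : ℝ, 0 < ε ∧
      ∀ (ρ T : ℝ) (x₀ : EuclideanSpace ℝ (Fin 3))
        (f u : ℝ → EuclideanSpace ℝ (Fin 3) → EuclideanSpace ℝ (Fin 3))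
        (p : ℝ → EuclideanSpace ℝ (Fin 3) → ℝ)
        (G : ℝ → EuclideanSpace ℝ (Fin 3) → EuclideanSpace ℝ (Fin 3) →L[ℝ] EuclideanSpace ℝ (Fin 3)),
        0 < ρ →
        IsLRSuitableWeakSolutionOn (parabolicCylinderOpens ρ (T, x₀)) ν 3 f u p G →
        ∀ z : ℝ × EuclideanSpace ℝ (Fin 3), z.1 ∈ Ioc (T - ρ ^ 2) T → z.2 ∈ ball x₀ ρ →
          limsup (fun r : ℝ => (ENNReal.ofReal r)⁻¹ *
              ∫⁻ w in parabolicCylinder r z, ENNReal.ofReal (frobeniusNormSq (G w.1 w.2)))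
            (𝓝[>] (0 : ℝ)) ≤ ENNReal.ofReal ε →
          ∃ r₁ : ℝ, 0 < r₁ ∧
            eLpNorm (uncurry u) ⊤ (volume.restrict (parabolicCylinder r₁ z)) < ⊤ := by
  obtain ⟨ε₁, hε₁, H⟩ := H
  obtain ⟨C₀, hIE⟩ := hIE
  intro ν hν
  -- the inflation factors `m = max 1 ν⁻¹`, `m' = max 1 ν`
  set m : ℝ := max 1 ν⁻¹ with hm
  have hm1 : 1 ≤ m := le_max_left _ _
  have hm0 : 0 < m := one_pos.trans_le hm1
  have hmν : ν⁻¹ ≤ m ^ 2 := le_sq_of_le_of_one_le (le_max_right _ _) hm1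
  set m' : ℝ := max 1 ν with hm'
  have hm'1 : 1 ≤ m' := le_max_left _ _
  have hm'0 : 0 < m' := one_pos.trans_le hm'1
  have hm'ν : ν ≤ m' ^ 2 := le_sq_of_le_of_one_le (le_max_right _ _) hm'1
  refine ⟨ε₁ * ν / (2 * m), by positivity, ?_⟩
  intro ρ T x₀ f u p G hρ hS z hzt hzx hlim
  obtain ⟨t, x⟩ := z
  dsimp only at hzt hzx hlim ⊢
  set F : ℝ × EuclideanSpace ℝ (Fin 3) → ℝ≥0∞ :=
    fun w => ENNReal.ofReal (frobeniusNormSq (G w.1 w.2)) with hF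
  -- ## a viscous cylinder `Q_ν((t, x), R)` inside `Q_ρ(T, x₀)`
  have hgt : 0 < t - (T - ρ ^ 2) := sub_pos.2 hzt.1
  have hgx : 0 < ρ - dist x x₀ := sub_pos.2 (mem_ball.1 hzx)
  obtain ⟨R, hR, hRt, hRx⟩ : ∃ R : ℝ, 0 < R ∧ R ^ 2 / ν < t - (T - ρ ^ 2) ∧ R < ρ - dist x x₀ := by
    refine ⟨min ((ρ - dist x x₀) / 2) (min 1 (ν * (t - (T - ρ ^ 2)) / 2)), by positivity, ?_, ?_⟩
    · set R := min ((ρ - dist x x₀) / 2) (min 1 (ν * (t - (T - ρ ^ 2)) / 2)) with hRdef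
      have hR0 : 0 ≤ R := by positivity
      have hR1 : R ≤ 1 := (min_le_right _ _).trans (min_le_left _ _)
      have hR2 : R ≤ ν * (t - (T - ρ ^ 2)) / 2 := (min_le_right _ _).trans (min_le_right _ _)
      rw [div_lt_iff₀ hν]
      calc R ^ 2 = R * R := sq R
        _ ≤ 1 * (ν * (t - (T - ρ ^ 2)) / 2) := mul_le_mul hR1 hR2 hR0 zero_le_one
        _ < (t - (T - ρ ^ 2)) * ν := by nlinarith [mul_pos hν hgt]
    · exact (min_le_left _ _).trans_lt (by linarith)
  have hVQ : viscousCylinder ν R (t, x) ⊆ parabolicCylinder ρ (T, x₀) := by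
    intro w hw
    rw [mem_viscousCylinder] at hw
    rw [mem_parabolicCylinder]
    obtain ⟨⟨h1, h2⟩, h3⟩ := hw
    dsimp only at h1 h2 h3 ⊢
    refine ⟨⟨by linarith, by linarith [hzt.2]⟩, ?_⟩
    calc dist w.2 x₀ ≤ dist w.2 x + dist x x₀ := dist_triangle _ _ _
      _ < ρ := by linarith
  have hVQ' : viscousCylinderOpens ν R (t, x) ≤ parabolicCylinderOpens ρ (T, x₀) := hVQ
  have hSV : IsLRSuitableWeakSolutionOn (viscousCylinderOpens ν R (t, x)) ν 3 f u p G :=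
    hS.of_le_of_isConnected hVQ' (isConnected_viscousCylinder hν hR _)
  have hGintV : ∫⁻ w in viscousCylinder ν R (t, x), F w < ⊤ := hSV.gradient_lt_top
  -- ## the rescaled datum on the unit cylinder, viscosity `(R/ν) ν / R = 1`
  have hα : 0 < R / ν := by positivity
  have hβ : 0 < R ^ 2 / ν := by positivity
  have hβ' : R ^ 2 / ν = R / ν * R := by ring
  have hn : Module.finrank ℝ (EuclideanSpace ℝ (Fin 3)) = 3 := finrank_euclideanSpace_fin
  set z₀ : ℝ × EuclideanSpace ℝ (Fin 3) := ((0 : ℝ), (0 : EuclideanSpace ℝ (Fin 3))) with hz₀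
  set f₁ : ℝ → EuclideanSpace ℝ (Fin 3) → EuclideanSpace ℝ (Fin 3) :=
    ((R / ν) ^ 2 * R) • stPull (R ^ 2 / ν) R t x f with hf₁
  set u₁ : ℝ → EuclideanSpace ℝ (Fin 3) → EuclideanSpace ℝ (Fin 3) :=
    (R / ν) • stPull (R ^ 2 / ν) R t x u with hu₁
  set p₁ : ℝ → EuclideanSpace ℝ (Fin 3) → ℝ := (R / ν) ^ 2 • stPull (R ^ 2 / ν) R t x p with hp₁
  set G₁ : ℝ → EuclideanSpace ℝ (Fin 3) → EuclideanSpace ℝ (Fin 3) →L[ℝ] EuclideanSpace ℝ (Fin 3) :=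
    (R / ν * R) • stPull (R ^ 2 / ν) R t x G with hG₁
  have h1 : IsLRSuitableWeakSolutionOn (parabolicCylinderOpens 1 z₀) 1 3 f₁ u₁ p₁ G₁ := by
    have h := hSV.stRescale hα hR hβ' t x
    have e1 : R / ν * ν / R = 1 := by field_simp
    rw [e1, stPreimage_viscousCylinderOpens_self hν hR, viscousCylinderOpens_one_one_zero] at h
    exact h
  have hsub1 : parabolicCylinder 1 z₀ ⊆
      ((parabolicCylinderOpens 1 z₀ : Opens (ℝ × EuclideanSpace ℝ (Fin 3))) :
        Set (ℝ × EuclideanSpace ℝ (Fin 3))) := Subset.rfl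
  -- ## `u₁ ∈ L³(Q₁)` by the interpolation inequality
  have hu3 : ∫⁻ w in parabolicCylinder 1 z₀, ‖u₁ w.1 w.2‖ₑ ^ (3 : ℕ) < ⊤ := by
    obtain ⟨CE₁, hCE₁⟩ := h1.energyClass
    have hA : cknAEss 1 z₀ u₁ ≤ (ENNReal.ofReal 1)⁻¹ * CE₁ := cknAEss_le_of_energy hCE₁ hsub1
    have hAfin : cknAEss 1 z₀ u₁ ≠ ⊤ :=
      ne_top_of_le_ne_top (ENNReal.mul_ne_top (by simp) ENNReal.coe_ne_top) hA
    have hEfin : cknE 1 z₀ G₁ ≠ ⊤ :=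
      ne_top_of_le_ne_top (ENNReal.mul_ne_top (by simp) h1.gradient_lt_top.ne)
        (cknE_le_of_subset G₁ hsub1)
    have hC := hIE u₁ G₁ z₀ 1 one_pos h1.weakGradient hAfin hEfin
    have hCfin : cknC 1 z₀ u₁ < ⊤ :=
      lt_of_le_of_lt hC (ENNReal.mul_lt_top ENNReal.coe_lt_top
        (ENNReal.rpow_lt_top_of_nonneg (by norm_num) (ENNReal.add_ne_top.2 ⟨hAfin, hEfin⟩)))
    rw [cknC, ENNReal.ofReal_one, one_pow, inv_one, one_mul] at hCfin
    exact hCfin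
  -- ## absorb the gradient part of the force into the pressure on the unit cylinder
  have hq32 : (3 : ℝ) / 2 ≤ 3 := by norm_num
  obtain ⟨Cg, Cπ, hH⟩ := exists_localHelmholtz (p := ENNReal.ofReal 3) (p32_le_ofReal hq32)
    ENNReal.ofReal_lt_top
  obtain ⟨π, 𝒢, hπ, h𝒢, -, -, hgrad, hdiv, πs, hπs, htπ, ht𝒢⟩ :=
    hH z₀ ((parabolicCylinder 1 z₀).indicator (uncurry f₁)) (memLp_indicator_cyl (memLp_f h1 hsub1))
      support_indicator_subset
  have h2 := isLRSuitableWeakSolutionOn_absorb h1 hq32 hsub1 hu3 hπ h𝒢 hgrad hπs htπ ht𝒢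
  have hdiv' : ∀ φ : ℝ → EuclideanSpace ℝ (Fin 3) → ℝ,
      IsSpaceTimeTestOn (parabolicCylinderOpens 1 z₀) φ →
        ∫ s, ∫ y, ⟪(fun s y => f₁ s y - 𝒢 (s, y)) s y, gradient (φ s) y⟫ = 0 :=
    fun φ hφ => divFree_absorb h1 hq32 hsub1 h𝒢 hdiv hφ
  -- ## the scaled dissipation of the rescaled pair: `E_w(r'; 0) ≤ (m/ν) E_u(mRr'; (t, x))`
  have hpre : ∀ r' : ℝ, parabolicCylinder r' z₀ =
      stAffine (R ^ 2 / ν) R t x ⁻¹' viscousCylinder ν (R * r') (t, x) := by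
    intro r'
    rw [hz₀, stAffine_preimage_viscousCylinder hν hR, mul_div_cancel_left₀ _ hR.ne']
  have key : ∀ r' : ℝ, 0 < r' →
      (ENNReal.ofReal r')⁻¹ * ∫⁻ w in parabolicCylinder r' z₀,
          ENNReal.ofReal (frobeniusNormSq (G₁ w.1 w.2)) ≤
        ENNReal.ofReal (m / ν) * ((ENNReal.ofReal (m * R * r'))⁻¹ *
          ∫⁻ w in parabolicCylinder (m * R * r') (t, x), F w) := by
    intro r' hr'
    rw [hpre r', hG₁, setLIntegral_frobeniusNormSq_stRescale hβ hR, hn]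
    have hsub : viscousCylinder ν (R * r') (t, x) ⊆ parabolicCylinder (m * R * r') (t, x) := by
      rw [mul_assoc]
      exact viscousCylinder_subset_parabolicCylinder hm1 hmν (by positivity) _
    have hconst : (ENNReal.ofReal r')⁻¹ * ENNReal.ofReal ((R / ν * R) ^ 2) *
        ENNReal.ofReal (R ^ 2 / ν * R ^ 3)⁻¹ =
        ENNReal.ofReal (m / ν) * (ENNReal.ofReal (m * R * r'))⁻¹ := by
      have hmRr : 0 < m * R * r' := by positivity
      rw [← ENNReal.ofReal_inv_of_pos hr', ← ENNReal.ofReal_inv_of_pos hmRr,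
        ← ENNReal.ofReal_mul (inv_nonneg.2 hr'.le),
        ← ENNReal.ofReal_mul (by positivity : (0 : ℝ) ≤ r'⁻¹ * (R / ν * R) ^ 2),
        ← ENNReal.ofReal_mul (by positivity : (0 : ℝ) ≤ m / ν)]
      congr 1
      field_simp
    calc (ENNReal.ofReal r')⁻¹ * (ENNReal.ofReal ((R / ν * R) ^ 2) *
          ENNReal.ofReal (R ^ 2 / ν * R ^ 3)⁻¹ * ∫⁻ w in viscousCylinder ν (R * r') (t, x), F w)
        = ENNReal.ofReal (m / ν) * ((ENNReal.ofReal (m * R * r'))⁻¹ *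
            ∫⁻ w in viscousCylinder ν (R * r') (t, x), F w) := by
          rw [← mul_assoc, ← mul_assoc, hconst, mul_assoc]
      _ ≤ ENNReal.ofReal (m / ν) * ((ENNReal.ofReal (m * R * r'))⁻¹ *
            ∫⁻ w in parabolicCylinder (m * R * r') (t, x), F w) :=
          mul_le_mul_right (mul_le_mul_right (lintegral_mono_set hsub) _) _
  -- the `limsup` smallness is inherited
  have h6 : limsup (fun r' : ℝ => (ENNReal.ofReal r')⁻¹ *
      ∫⁻ w in parabolicCylinder r' z₀, ENNReal.ofReal (frobeniusNormSq (G₁ w.1 w.2)))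
      (𝓝[>] (0 : ℝ)) ≤ ENNReal.ofReal ε₁ := by
    have hε : 0 < ε₁ * ν / (2 * m) := by positivity
    obtain ⟨rE, hrE, hElt⟩ := exists_forall_lt_of_limsup_le hlim
      ((ENNReal.ofReal_lt_ofReal_iff (by positivity)).2
        (by linarith : ε₁ * ν / (2 * m) < 2 * (ε₁ * ν / (2 * m))))
    refine Filter.limsup_le_of_le (by isBoundedDefault) ?_
    have hev : ∀ᶠ r' in 𝓝[>] (0 : ℝ), 0 < r' ∧ r' < rE / (m * R) :=
      Ioo_mem_nhdsGT (by positivity)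
    filter_upwards [hev] with r' hr'
    refine (key r' hr'.1).trans ?_
    have hlt : m * R * r' < rE := by
      have := hr'.2
      rwa [lt_div_iff₀ (by positivity), mul_comm] at this
    have h7 := (hElt (m * R * r') (mul_pos (mul_pos hm0 hR) hr'.1) hlt).le
    calc ENNReal.ofReal (m / ν) * ((ENNReal.ofReal (m * R * r'))⁻¹ *
          ∫⁻ w in parabolicCylinder (m * R * r') (t, x), F w)
        ≤ ENNReal.ofReal (m / ν) * ENNReal.ofReal (2 * (ε₁ * ν / (2 * m))) := mul_le_mul_right h7 _
      _ = ENNReal.ofReal ε₁ := by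
          rw [← ENNReal.ofReal_mul (by positivity)]
          congr 1
          field_simp
  -- ## the unit statement at the top centre `(0, 0)`, and the transport back
  obtain ⟨r₁', hr₁', hbd⟩ := H 1 0 0 _ u₁ _ G₁ one_pos h2 hdiv' z₀
    (by rw [hz₀]; norm_num) (by rw [hz₀]; exact mem_ball_self one_pos) h6
  set S : ℝ≥0∞ := eLpNorm (uncurry u₁) ⊤ (volume.restrict (parabolicCylinder r₁' z₀)) with hSdef
  have hSfin : S ≠ ⊤ := hbd.ne
  have hae : ∀ᵐ z ∂(volume.restrict (parabolicCylinder r₁' z₀)),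
      ‖(R / ν) • u (stAffine (R ^ 2 / ν) R t x z).1 (stAffine (R ^ 2 / ν) R t x z).2‖ ≤ S.toReal := by
    have h := ae_le_eLpNormEssSup (f := uncurry u₁)
      (μ := volume.restrict (parabolicCylinder r₁' z₀))
    filter_upwards [h] with z hz
    have e : uncurry u₁ z =
        (R / ν) • u (stAffine (R ^ 2 / ν) R t x z).1 (stAffine (R ^ 2 / ν) R t x z).2 := rfl
    rw [← e, ← toReal_enorm]
    refine ENNReal.toReal_mono hSfin ?_
    rw [hSdef, eLpNorm_exponent_top]
    exact hz
  rw [hpre r₁'] at hae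
  have h8 := ae_restrict_of_ae_restrict_preimage_stAffine hβ hR t x
    (P := fun z => ‖(R / ν) • u z.1 z.2‖ ≤ S.toReal) hae
  -- `Q_{R r₁' / m'}(t, x) ⊆ Q_ν((t, x), R r₁')`
  have hsub : parabolicCylinder (R * r₁' / m') (t, x) ⊆ viscousCylinder ν (R * r₁') (t, x) :=
    parabolicCylinder_subset_viscousCylinder hν hm'1 hm'ν (by positivity) _
  refine ⟨R * r₁' / m', by positivity, ?_⟩
  rw [eLpNorm_exponent_top]
  refine eLpNormEssSup_lt_top_of_ae_bound (C := S.toReal / (R / ν)) ?_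
  filter_upwards [ae_restrict_of_ae_restrict_of_subset hsub h8] with z hz
  rw [norm_smul, Real.norm_eq_abs, abs_of_pos hα] at hz
  rw [le_div_iff₀ hα, mul_comm]
  exact hz

/-- **Tsai 1998, Lemma 4.2 WITH A FORCE** (Caffarelli–Kohn–Nirenberg 1982, Proposition 2, with
backward cylinders so that the point may lie on the top of the cylinder): for every `ν > 0` there
is `ε > 0` such that for every datum `(Q_ρ(T, x₀), f, u, p, G)` in Lemarié-Rieusset's §14.3 class
with viscosity `ν` and a force `f ∈ L³(Q_ρ(T, x₀))` (no solenoidality assumed) and every point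
`z = (t, x)`, `T - ρ² < t ≤ T`, `x ∈ B_ρ(x₀)`: `limsup_{r→0⁺} r⁻¹ ∫∫_{Q_r(z)} |G|² ≤ ε` implies
`u ∈ L^∞(Q_{r₁}(z))` for some `r₁ > 0`. No hypotheses beyond the datum
(`tsai1998_lemma42_forced_unit`, `interpolationEstimate_holds`).
[cite: Tsai1998, Lemma 4.2 (p. 46)] [cite: CaffarelliKohnNirenberg1982, Proposition 2 and §1] -/
theorem tsai1998_lemma42_forced :
    ∀ ν : ℝ, 0 < ν → ∃ ε : ℝ, 0 < ε ∧
      ∀ (ρ T : ℝ) (x₀ : EuclideanSpace ℝ (Fin 3))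
        (f u : ℝ → EuclideanSpace ℝ (Fin 3) → EuclideanSpace ℝ (Fin 3))
        (p : ℝ → EuclideanSpace ℝ (Fin 3) → ℝ)
        (G : ℝ → EuclideanSpace ℝ (Fin 3) → EuclideanSpace ℝ (Fin 3) →L[ℝ] EuclideanSpace ℝ (Fin 3)),
        0 < ρ →
        IsLRSuitableWeakSolutionOn (parabolicCylinderOpens ρ (T, x₀)) ν 3 f u p G →
        ∀ z : ℝ × EuclideanSpace ℝ (Fin 3), z.1 ∈ Ioc (T - ρ ^ 2) T → z.2 ∈ ball x₀ ρ →
          limsup (fun r : ℝ => (ENNReal.ofReal r)⁻¹ *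
              ∫⁻ w in parabolicCylinder r z, ENNReal.ofReal (frobeniusNormSq (G w.1 w.2)))
            (𝓝[>] (0 : ℝ)) ≤ ENNReal.ofReal ε →
          ∃ r₁ : ℝ, 0 < r₁ ∧
            eLpNorm (uncurry u) ⊤ (volume.restrict (parabolicCylinder r₁ z)) < ⊤ :=
  tsai1998_lemma42_forced_of_unit interpolationEstimate_holds tsai1998_lemma42_forced_unit

/-! ## The singular set at the top of the cylinder is `μH[1]`-null, with force -/

/-- **THE TOP SINGULAR SET IS `μH[1]`-NULL, WITH A FORCE** (Tsai 1998, remark after Lemma 4.2: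
"as in the proof of Theorem B in [CKN, p. 807], this lemma implies that the singular set at the
top of the parabolic cylinder also has one-dimensional Hausdorff measure zero" — here for the
forced equations, Caffarelli–Kohn–Nirenberg's Theorem B carrying a force). Let `ν > 0`, `ρ > 0` and
let `(Q_ρ(T, x₀), f, u, p, G)` lie in Lemarié-Rieusset's §14.3 class with force exponent `3`
(`u ∈ L^∞_t L²_x`, `G = ∇u` with `∫∫ |G|² < ∞`, `p ∈ L^{3/2}`, `f ∈ L³` on the cylinder, the
equations in `𝒟'`, the local energy inequality). Then the set of `x ∈ B_ρ(x₀)` such that `(T, x)`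
is a backward singular point (`IsBackwardSingularPoint u (T, x)`: `u` essentially unbounded on
every `Q_r(T, x)`) has one-dimensional Hausdorff measure zero. The covering argument is the
tree's `tsai1998_top_singular_null_of_lemma42` verbatim (Vitali covering by the base balls,
`Σ rᵢ ≤ ε⁻¹ ∫∫_{Q_ρ ∩ {t > T - δ²}} |∇u|² → 0`), fed with `tsai1998_lemma42_forced`.
[cite: Tsai1998, remark after Lemma 4.2 (p. 46)] [cite: CaffarelliKohnNirenberg1982, Theorem B (proof, §6 p. 807)] -/
theorem tsai1998_top_singular_null_forced {ν ρ T : ℝ} {x₀ : EuclideanSpace ℝ (Fin 3)}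
    (hν : 0 < ν) (hρ : 0 < ρ)
    {f u : ℝ → EuclideanSpace ℝ (Fin 3) → EuclideanSpace ℝ (Fin 3)}
    {p : ℝ → EuclideanSpace ℝ (Fin 3) → ℝ}
    {G : ℝ → EuclideanSpace ℝ (Fin 3) → EuclideanSpace ℝ (Fin 3) →L[ℝ] EuclideanSpace ℝ (Fin 3)}
    (hS : IsLRSuitableWeakSolutionOn (parabolicCylinderOpens ρ (T, x₀)) ν 3 f u p G) :
    μH[1] {x ∈ ball x₀ ρ | IsBackwardSingularPoint u (T, x)} = 0 := by
  obtain ⟨ε, hε, H⟩ := tsai1998_lemma42_forced ν hν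
  set Q : Set (ℝ × EuclideanSpace ℝ (Fin 3)) := parabolicCylinder ρ (T, x₀) with hQ
  set F : ℝ × EuclideanSpace ℝ (Fin 3) → ℝ≥0∞ :=
    fun w => ENNReal.ofReal (frobeniusNormSq (G w.1 w.2)) with hF
  set S : Set (EuclideanSpace ℝ (Fin 3)) := {x ∈ ball x₀ ρ | IsBackwardSingularPoint u (T, x)}
    with hSdef
  have hGint : ∫⁻ w in Q, F w < ⊤ := hS.gradient_lt_top
  -- the finite measure `|∇u|² dx dt` on the cylinder
  set μ : Measure (ℝ × EuclideanSpace ℝ (Fin 3)) := (volume.restrict Q).withDensity F with hμ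
  haveI : IsFiniteMeasure μ := by
    refine isFiniteMeasure_withDensity ?_
    exact hGint.ne
  have hμ_apply : ∀ {B : Set (ℝ × EuclideanSpace ℝ (Fin 3))}, MeasurableSet B → B ⊆ Q →
      μ B = ∫⁻ w in B, F w := by
    intro B hB hBQ
    rw [hμ, withDensity_apply _ hB, Measure.restrict_restrict hB, inter_eq_left.2 hBQ]
  -- Step 1: at a singular top point, arbitrarily small cylinders carry `≥ ε r` of dissipation.
  have key : ∀ x ∈ S, ∀ δ : ℝ, 0 < δ → ∃ r : ℝ, 0 < r ∧ r ≤ δ ∧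
      closedBall x r ⊆ ball x₀ ρ ∧ r ≤ ρ ∧
      ENNReal.ofReal (ε * r) ≤ μ (parabolicCylinder r (T, x)) := by
    intro x hx δ hδ
    have hxball : x ∈ ball x₀ ρ := hx.1
    have hlim : ENNReal.ofReal ε < limsup (fun r : ℝ => (ENNReal.ofReal r)⁻¹ *
        ∫⁻ w in parabolicCylinder r (T, x), F w) (𝓝[>] (0 : ℝ)) := by
      by_contra hle
      push Not at hle
      obtain ⟨r₁, hr₁, hbd⟩ := H ρ T x₀ f u p G hρ hS (T, x)
        ⟨by simp only; nlinarith [hρ], le_rfl⟩ hxball hle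
      exact absurd (hx.2 r₁ hr₁) hbd.ne
    have hfreq := frequently_lt_of_lt_limsup (by isBoundedDefault) hlim
    have hgap : 0 < ρ - dist x x₀ := sub_pos.2 (mem_ball.1 hxball)
    have hev : ∀ᶠ r in 𝓝[>] (0 : ℝ), 0 < r ∧ r ≤ δ ∧ closedBall x r ⊆ ball x₀ ρ ∧ r ≤ ρ := by
      filter_upwards [Ioo_mem_nhdsGT (lt_min hδ hgap)] with r hr
      refine ⟨hr.1, (hr.2.le.trans (min_le_left _ _)), ?_, ?_⟩
      · exact closedBall_subset_ball' (by linarith [hr.2.trans_le (min_le_right δ _)])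
      · linarith [hr.2.trans_le (min_le_right δ _), dist_nonneg (x := x) (y := x₀)]
    obtain ⟨r, ⟨hr0, hrδ, hrball, hrρ⟩, hr⟩ := (hev.and_frequently hfreq).exists
    refine ⟨r, hr0, hrδ, hrball, hrρ, ?_⟩
    have hsubQ : parabolicCylinder r (T, x) ⊆ Q := by
      rw [hQ, parabolicCylinder, parabolicCylinder]
      exact prod_mono (Ioo_subset_Ioo_left (by nlinarith)) (ball_subset_closedBall.trans hrball)
    rw [hμ_apply (isOpen_parabolicCylinder r _).measurableSet hsubQ]
    rw [← ENNReal.div_eq_inv_mul, ENNReal.lt_div_iff_mul_lt (Or.inl (ENNReal.ofReal_pos.2 hr0).ne')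
      (Or.inl ENNReal.ofReal_ne_top), ← ENNReal.ofReal_mul hε.le] at hr
    exact hr.le
  -- Step 2: for every `δ > 0`, a countable cover of `S` by closed balls of radii `≤ 4δ` whose radii
  -- sum to at most `ε⁻¹ μ(Q ∩ {t > T - δ²})`.
  have cover : ∀ δ : ℝ, 0 < δ → ∃ (ι : Type) (_ : Countable ι) (t : ι → Set (EuclideanSpace ℝ (Fin 3))),
      (∀ i, Metric.ediam (t i) ≤ ENNReal.ofReal (8 * δ)) ∧ S ⊆ ⋃ i, t i ∧
      ∑' i, Metric.ediam (t i) ≤ ENNReal.ofReal (8 / ε) * μ (Ioi (T - δ ^ 2) ×ˢ univ) := by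
    intro δ hδ
    choose! r hr using key
    obtain ⟨U, hUS, hdisj, hcov⟩ := Vitali.exists_disjoint_subfamily_covering_enlargement_closedBall
      S id (fun x => r x δ) δ (fun a ha => (hr a ha δ hδ).2.1) 4 (by norm_num)
    have hUc : U.Countable := by
      refine hdisj.countable_of_nonempty_interior fun b hb => ⟨b, ?_⟩
      exact ball_subset_interior_closedBall (mem_ball_self (hr b (hUS hb) δ hδ).1)
    haveI : Countable U := hUc.to_subtype
    refine ⟨U, inferInstance, fun b => closedBall (b : EuclideanSpace ℝ (Fin 3)) (4 * r b δ),
      fun b => ?_, ?_, ?_⟩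
    · -- diameters
      have hb := hr b (hUS b.2) δ hδ
      calc Metric.ediam (closedBall (b : EuclideanSpace ℝ (Fin 3)) (4 * r b δ))
            ≤ ENNReal.ofReal (2 * (4 * r b δ)) :=
            ediam_closedBall_le_ofReal _ (by linarith [hb.1])
        _ ≤ ENNReal.ofReal (8 * δ) := ENNReal.ofReal_le_ofReal (by linarith [hb.2.1])
    · -- cover
      intro a ha
      obtain ⟨b, hbU, hab⟩ := hcov a ha
      exact mem_iUnion.2 ⟨⟨b, hbU⟩, hab (mem_closedBall_self (hr a ha δ hδ).1.le)⟩
    · -- the sum of the radii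
      have hsub : ∀ b : U, parabolicCylinder (r b δ) (T, (b : EuclideanSpace ℝ (Fin 3))) ⊆
          Ioi (T - δ ^ 2) ×ˢ univ := by
        intro b w hw
        have hb := hr b (hUS b.2) δ hδ
        rw [mem_parabolicCylinder] at hw
        refine ⟨?_, mem_univ _⟩
        have : r b δ ^ 2 ≤ δ ^ 2 := pow_le_pow_left₀ hb.1.le hb.2.1 2
        simp only [mem_Ioi]
        linarith [hw.1.1]
      have hdisj' : Pairwise (Disjoint on fun b : U =>
          parabolicCylinder (r b δ) (T, (b : EuclideanSpace ℝ (Fin 3)))) := by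
        intro b₁ b₂ hne
        have hne' : (b₁ : EuclideanSpace ℝ (Fin 3)) ≠ b₂ := fun h => hne (Subtype.ext h)
        exact disjoint_parabolicCylinder_of_disjoint_closedBall (hdisj b₁.2 b₂.2 hne')
      calc ∑' b : U, Metric.ediam (closedBall (b : EuclideanSpace ℝ (Fin 3)) (4 * r b δ))
          ≤ ∑' b : U, ENNReal.ofReal (8 / ε) *
              μ (parabolicCylinder (r b δ) (T, (b : EuclideanSpace ℝ (Fin 3)))) := by
            refine ENNReal.tsum_le_tsum fun b => ?_
            have hb := hr b (hUS b.2) δ hδ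
            calc Metric.ediam (closedBall (b : EuclideanSpace ℝ (Fin 3)) (4 * r b δ))
                ≤ ENNReal.ofReal (2 * (4 * r b δ)) := ediam_closedBall_le_ofReal _ (by linarith [hb.1])
              _ = ENNReal.ofReal (8 / ε) * ENNReal.ofReal (ε * r b δ) := by
                  rw [← ENNReal.ofReal_mul (by positivity)]
                  congr 1
                  field_simp
                  ring
              _ ≤ ENNReal.ofReal (8 / ε) *
                  μ (parabolicCylinder (r b δ) (T, (b : EuclideanSpace ℝ (Fin 3)))) :=
                  mul_le_mul_right hb.2.2.2.2 _
        _ = ENNReal.ofReal (8 / ε) *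
              μ (⋃ b : U, parabolicCylinder (r b δ) (T, (b : EuclideanSpace ℝ (Fin 3)))) := by
            rw [ENNReal.tsum_mul_left, measure_iUnion hdisj'
              (fun b => (isOpen_parabolicCylinder _ _).measurableSet)]
        _ ≤ ENNReal.ofReal (8 / ε) * μ (Ioi (T - δ ^ 2) ×ˢ univ) :=
            mul_le_mul_right (measure_mono (iUnion_subset hsub)) _
  -- Step 3: `μH[1](S) ≤ liminf_n (8/ε) μ(Q ∩ {t > T - δₙ²}) = 0`, `δₙ = (n + 1)⁻¹`.
  set δs : ℕ → ℝ := fun n => ((n : ℝ) + 1)⁻¹ with hδs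
  have hδpos : ∀ n, 0 < δs n := fun n => by positivity
  choose ι hι t hdiam hcov hsum using fun n : ℕ => cover (δs n) (hδpos n)
  have hδlim : Tendsto δs atTop (𝓝 0) := tendsto_one_div_add_atTop_nhds_zero_nat.congr fun n => by
    simp [hδs]
  have hbound : μH[1] S ≤ liminf (fun n => ∑' i, Metric.ediam (t n i) ^ (1 : ℝ)) atTop := by
    haveI := hι
    refine Measure.hausdorffMeasure_le_liminf_tsum 1 S (fun n => ENNReal.ofReal (8 * δs n)) ?_ t
      (Eventually.of_forall hdiam) (Eventually.of_forall hcov)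
    rw [← ENNReal.ofReal_zero]
    exact ENNReal.tendsto_ofReal (by simpa using hδlim.const_mul 8)
  set A : ℕ → Set (ℝ × EuclideanSpace ℝ (Fin 3)) := fun n => Ioi (T - δs n ^ 2) ×ˢ univ with hA
  have hAanti : Antitone A := by
    intro m n hmn
    refine prod_mono (Ioi_subset_Ioi ?_) Subset.rfl
    have h1 : δs n ≤ δs m := by
      simp only [hδs]
      exact inv_anti₀ (by positivity) (by exact_mod_cast Nat.succ_le_succ hmn |>.trans_eq rfl)
    nlinarith [hδpos n, hδpos m]
  have hAlim : Tendsto (fun n => μ (A n)) atTop (𝓝 (μ (⋂ n, A n))) :=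
    tendsto_measure_iInter_atTop
      (fun n => (measurableSet_Ioi.prod MeasurableSet.univ).nullMeasurableSet)
      hAanti ⟨0, measure_ne_top μ _⟩
  have hAempty : μ (⋂ n, A n) = 0 := by
    have hmeasI : MeasurableSet (⋂ n, A n) :=
      MeasurableSet.iInter fun n => measurableSet_Ioi.prod MeasurableSet.univ
    rw [hμ, withDensity_apply _ hmeasI, Measure.restrict_restrict hmeasI]
    have hempty : (⋂ n, A n) ∩ Q = ∅ := by
      ext w
      simp only [mem_inter_iff, mem_iInter, mem_empty_iff_false, iff_false, not_and]
      intro hw hwQ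
      rw [hQ, mem_parabolicCylinder] at hwQ
      have hgap : 0 < T - w.1 := sub_pos.2 hwQ.1.2
      obtain ⟨n, hn⟩ := exists_nat_one_div_lt hgap
      have hwn := (hw n).1
      simp only [mem_Ioi] at hwn
      have hδ1 : δs n ≤ 1 := by
        simp only [hδs]
        exact inv_le_one_of_one_le₀ (by linarith [n.cast_nonneg (α := ℝ)])
      have hsq : δs n ^ 2 ≤ δs n := by nlinarith [hδpos n]
      have : δs n < T - w.1 := by simpa [hδs, one_div] using hn
      linarith
    rw [hempty, Measure.restrict_empty, lintegral_zero_measure]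
  have hlim2 : Tendsto (fun n => ENNReal.ofReal (8 / ε) * μ (A n)) atTop (𝓝 0) := by
    have := ENNReal.Tendsto.const_mul hAlim (Or.inr ENNReal.ofReal_ne_top) (a := ENNReal.ofReal (8 / ε))
    rwa [hAempty, mul_zero] at this
  refine le_antisymm ?_ (zero_le)
  calc μH[1] S ≤ liminf (fun n => ∑' i, Metric.ediam (t n i) ^ (1 : ℝ)) atTop := hbound
    _ ≤ liminf (fun n => ENNReal.ofReal (8 / ε) * μ (A n)) atTop := by
        refine liminf_le_liminf (Eventually.of_forall fun n => ?_)
        simp only [ENNReal.rpow_one]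
        exact hsum n
    _ = 0 := hlim2.liminf_eq

end Literature.Analysis.FluidPDE

end
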